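import Literature.AnabelianGeometry.AbsoluteAnabelian.ArchimedeanHolFieldFunctorGeometricOuterRigid
import Literature.AnabelianGeometry.AbsoluteAnabelian.ArchimedeanHolFieldFunctorGeometricOverIdRigidTorus
import Literature.AnabelianGeometry.AbsoluteAnabelian.HolomorphicEllipticCuspidalizationFiniteEtaleRigidity
import Literature.GroupTheory.ProfiniteCompletionInnerInvariants
import Literature.Geometry.Kaehler.ComplexTorusMapsHomotopyClassification
import Literature.Geometry.Kaehler.ComplexTorusFundamentalGroupHomology
import HarnessLib

/-!
# [AbsTopIII] Prop. 4.2 (i) at the once-punctured elliptic curve, unconditionally: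
# «`Aut(E ∖ {0}) → Out(π̂₁)` is injective» and «objects of `EA` mapping to `E ∖ {0}`» is id-rigid

S. Mochizuki, *Topics in Absolute Anabelian Geometry III*, Lemma 4.3 and the proof of Prop. 4.2 (i),
kurims p.106. [cite: MochizukiAbsTopIII2015, Proposition 4.2 (i) p.106]

PROOF-ONLY file (abc-iut cell, seat abc-iut-w5-d144 gen 4, row «H1PRIME-ELLIPTIC»; campaign-L R1.2,
GAP row G-L4t14-R1, NODES AbsTopIII:Prop4.2(i)/Cor4.5 geometric column).  The per-object residual (OUT)
of `ArchimedeanHolFieldFunctorGeometricOuterRigid` — «an automorphism of `𝕏` acting on `π̂₁(𝕏^top)` by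
an inner automorphism is trivial» — is DISCHARGED for the once-punctured elliptic curve
`𝕏 = E ∖ {0}` (`HolRS.puncturedTorus Φ 0`, `E = ℂ/Φ(ℤ²)`), the hyperbolic curve of type `(1,1)`
carrying the elliptic cuspidalization of [AbsTopIII] Cor. 2.7 and IUT's `X_v` at an archimedean place.
Here the abelian criterion (H1) of the cell's first files is FALSE (`[-1] ∈ Aut(E, 0)` commutes with
everything), so this is the first object of the column settled through print's own route.

Proof.  `σ ∈ Aut(𝕏)` extends to a holomorphic additive automorphism `Γ` of the torus
(abc-iut-w5-d208's `HolomorphicEllipticCuspidalization.exists_continuousAddEquiv_extension`), hence is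
affine, `Γ = ρ(ρ_Γ) + Γ(0)` (Lange 2023 Prop. 1.1.6, the tree's
`ComplexTorus.eq_mapMatrix_topRep_add_of_mdifferentiable`), and `ρ_Γ ∈ GL₂(ℤ)` is read off the periods:
`D(Γ ∘ γ) = ρ_ℝ(ρ_Γ) D(γ)` (`ComplexTorus.pathDisplacement_map_eq_realRep_topRep`, moved to any base
point).  A profinitely inner `θ` with `σ_* (θ γ) = δ⁻¹·γ·δ` is invisible to the lattice coordinates
`π₁(𝕏) → π₁(E) = Λ ≅ ℤ²` (`Literature.GroupTheory.map_eq_of_eta_conj_of_separating`, `ℤ²` being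
residually finite), and conjugation by `δ` does not change periods; so `ρ_ℝ(ρ_Γ)` fixes the period of
every loop of `𝕏` at the base point, in particular `Φ(e₁), Φ(e₂)` (two explicit loops inside `E ∖ {0}`
at `π(Φ(½,½))`), whence `ρ_Γ = 1`, `Γ = id`, `σ = 1`.

* `HolRS.pathDisplacement_congr`, `HolRS.pathDisplacement_map_addEquiv`, `HolRS.latticeVec_single_injective`
  — torus lemmas (periods of pointwise-equal paths; `D(Γ ∘ γ) = ρ_ℝ(ρ_Γ) D γ` at any base point;
  an integer matrix fixing `Φ(e_i)` is `1`);
* `HolRS.puncturedTorus_zero_outer` — **(OUT) at `E ∖ {0}`** (for a base point carrying the basic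
  loops);
* `HolRS.cover_ne_zero_of_coord_eq_half`, `HolRS.exists_basepoint_basis_loops` — the base point
  `π(Φ(½,½))` and its two basic loops inside `E ∖ {0}`;
* `HolRS.isIdRigid_mapsTo_puncturedTorus_zero` — **«objects of `EA` mapping to `E ∖ {0}`» is
  id-rigid, UNCONDITIONALLY** (`isIdRigid_mapsTo_of_isSlimGroup_of_outer` with `π̂₁(E ∖ {0}) = F̂₂`
  slim, abc-iut-w5-d016 / abc-iut-L4-t12, and (OUT)).
* §4 (appended) `HolRS.nonempty_iso_puncturedTorus_zero`, `HolRS.isIdRigid_mapsTo_puncturedTorus` —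
  the same for every `E ∖ {x₀}` by translation.

Classical mathematics; no definition, no instance, no Prop-valued fact; nothing here bears on
[IUTchIII] Cor. 3.12; model ≠ reconstruction; support library, not a node.

## References

* S. Mochizuki, *Topics in Absolute Anabelian Geometry III*, kurims ms, Lemma 4.3 / Prop. 4.2 (i)
  p.106. [MochizukiAbsTopIII2015]
* H. Lange, *Abelian Varieties over the Complex Numbers* (2023), §1.1.2 Prop. 1.1.6, §1.1.3 (1.3).
  [Lange2023AbelianVarietiesComplex]
* A. Hatcher, *Algebraic Topology* (2002), Prop. 1B.9. [HatcherAT2002]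
-/

noncomputable section

open CategoryTheory Topology
open scoped Manifold ContDiff
open Literature.Topology.CoveringSpaces
open Literature.AlgebraicGeometry.Frobenioids (IsSlimGroup)
open Literature.IUT.HodgeTheaters (profiniteCompletion toCompletion)
open Literature.Geometry.Kaehler Literature.Geometry.Kaehler.ComplexTorus

namespace Literature.AnabelianGeometry.AbsoluteAnabelian

namespace HolRS

variable (Φ : (Fin 2 → ℝ) ≃L[ℝ] ℂ)

/-! ### §1 Torus lemmas: displacements of pointwise-equal paths, of translates, of images under an
additive holomorphic map -/

/-- The displacement of a path in the torus depends only on its underlying function.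
[cite: Lange2023AbelianVarietiesComplex, §1.1.2 Lemma 1.1.3] -/
theorem pathDisplacement_congr {x y x' y' : ComplexTorus Φ} (γ : Path x y) (γ' : Path x' y')
    (h : ∀ t, γ t = γ' t) : pathDisplacement Φ γ = pathDisplacement Φ γ' := by
  obtain ⟨L, hL, -⟩ := exists_pathLift Φ γ (e := Φ (lift Φ x)) (by rw [cover_apply_apply, proj_lift])
  rw [pathDisplacement_eq_sub_of_lift Φ γ L.continuous hL,
    pathDisplacement_eq_sub_of_lift Φ γ' L.continuous (fun t => (hL t).trans (h t))]

/-- **Displacement under an additive continuous self-map of the torus**: for a continuous additive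
`Γ : T → T` and ANY loop `γ` (at any base point), `D(Γ ∘ γ) = ρ_ℝ(ρ_Γ) (D γ)` — the tree's
`pathDisplacement_map_eq_realRep_topRep` (loops at `0`) moved to a general base point by translation.
[cite: Lange2023AbelianVarietiesComplex, §1.1.3 (1.3)] [cite: HatcherAT2002, Prop. 1B.9] -/
theorem pathDisplacement_map_addEquiv (Γ : ComplexTorus Φ ≃ₜ+ ComplexTorus Φ) {x : ComplexTorus Φ}
    (γ : Path x x) :
    pathDisplacement Φ (γ.map Γ.continuous) =
      realRep Φ Φ (topRep (Φ₁ := Φ) (Φ := Φ) Γ.continuous) (pathDisplacement Φ γ) := by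
  -- translate `γ` to a loop at `0`
  have hc : Continuous fun y : ComplexTorus Φ => y + (-x) := continuous_id.add continuous_const
  let γ₀ : Path (0 : ComplexTorus Φ) 0 := (γ.map hc).cast (by simp) (by simp)
  have h₀ : pathDisplacement Φ γ₀ = pathDisplacement Φ γ := by
    have h1 : pathDisplacement Φ γ₀ = pathDisplacement Φ (γ.map hc) :=
      pathDisplacement_congr Φ _ _ (fun t => rfl)
    rw [h1, pathDisplacement_map_add_right]
  -- `Γ ∘ γ = (Γ ∘ γ₀) + Γ x`
  have hc' : Continuous fun y : ComplexTorus Φ => y + Γ x := continuous_id.add continuous_const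
  have h2 : pathDisplacement Φ (γ.map Γ.continuous) =
      pathDisplacement Φ ((γ₀.map Γ.continuous).map hc') := by
    refine pathDisplacement_congr Φ _ _ (fun t => ?_)
    change Γ (γ t) = Γ (γ t + -x) + Γ x
    rw [map_add, map_neg, neg_add_cancel_right]
  rw [h2, pathDisplacement_map_add_right, pathDisplacement_map_eq_realRep_topRep Γ.continuous γ₀, h₀]

/-- An integer `2 × 2` matrix whose action on the lattice fixes `Φ(e₁)`, `Φ(e₂)` is the identity.
[folklore] -/
private theorem latticeVec_single_injective {M : Matrix (Fin 2) (Fin 2) ℤ}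
    (hM : ∀ i, latticeVec Φ (M.mulVec (Pi.single i 1)) = latticeVec Φ (Pi.single i 1)) : M = 1 := by
  ext i j
  have h := hM j
  have h' : M.mulVec (Pi.single j 1) = Pi.single j 1 := by
    have hinj : Function.Injective (latticeVec Φ) := by
      intro a b hab
      have := Φ.injective hab
      funext k
      exact_mod_cast congrFun this k
    exact hinj h
  have hij : M i j = (Pi.single j (1 : ℤ) : Fin 2 → ℤ) i := by
    have := congrFun h' i
    rwa [Matrix.mulVec_single_one] at this
  rw [hij, Matrix.one_apply, Pi.single_apply]

/-! ### §2 (OUT) for the once-punctured elliptic curve `E ∖ {0}` -/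

/-- **(OUT) at the once-punctured elliptic curve.**  Let `𝕏 = E ∖ {0}` (`puncturedTorus Φ 0`), `x′` a
base point at which the two basic lattice loops can be drawn inside `𝕏` (hypothesis `hx′`), `σ` an
automorphism of `𝕏` in `HolRS`, `δ` a path from `x′` to `σ x′`, and `θ` an endomorphism of
`π₁(𝕏^top, x′)` with `σ_* (θ γ) = δ⁻¹ · γ · δ`.  If `θ` is INNER on the profinite completion
`π̂₁(𝕏^top, x′)`, then `σ = 1`.  Proof: `σ` extends to a holomorphic additive automorphism `Γ` of the
torus (abc-iut-w5-d208's `exists_continuousAddEquiv_extension`), which is affine, `Γ = ρ(ρ_Γ) + Γ(0)`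
(Lange Prop. 1.1.6, the tree's `eq_mapMatrix_topRep_add_of_mdifferentiable`); profinitely inner `θ` is
invisible to the lattice coordinates `π₁(𝕏) → π₁(E) = Λ ≅ ℤ²` (`map_eq_of_eta_conj_of_separating`), so
`ρ_Γ` fixes the periods `D(γ) ∈ Λ` of all loops of `𝕏` at `x′`, in particular a basis: `ρ_Γ = 1`,
`Γ = id`, `σ = 1`.  This is [AbsTopIII] Lemma 4.3's input «`Aut(X) → Out(Π_X)` injective» at the
geometric model of type `(1,1)`, where the abelian (H1) fails (`[-1] ∈ Aut`).
[cite: MochizukiAbsTopIII2015, Lemma 4.3 p.106] [cite: Lange2023AbelianVarietiesComplex, §1.1.2 Prop. 1.1.6] -/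
theorem puncturedTorus_zero_outer (x' : (puncturedTorus Φ 0).carrier)
    (hx' : ∀ i : Fin 2, ∃ γ : Path x' x',
      pathDisplacement Φ (γ.map continuous_subtype_val) = latticeVec Φ (Pi.single i 1))
    (σ : puncturedTorus Φ 0 ≅ puncturedTorus Φ 0) (δ : Path x' (σ.hom.toFun x'))
    (θ : FundamentalGroup (puncturedTorus Φ 0).carrier x' →* FundamentalGroup (puncturedTorus Φ 0).carrier x')
    (hθ : ∀ γ : FundamentalGroup (puncturedTorus Φ 0).carrier x',
      Path.Homotopic.Quotient.map (FundamentalGroup.toPath (θ γ))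
          ⟨σ.hom.toFun, σ.hom.mdifferentiable.continuous⟩ =
        (Path.Homotopic.Quotient.mk δ).symm.trans
          ((FundamentalGroup.toPath γ).trans (Path.Homotopic.Quotient.mk δ)))
    (hn : ∃ n : profiniteCompletion (FundamentalGroup (puncturedTorus Φ 0).carrier x'),
      ∀ γ, toCompletion _ (θ γ) = n⁻¹ * toCompletion _ γ * n) :
    σ.hom = 𝟙 (puncturedTorus Φ 0) := by
  classical
  obtain ⟨n, hn⟩ := hn
  let incl : C((puncturedTorus Φ 0).carrier, ComplexTorus Φ) := ⟨Subtype.val, continuous_subtype_val⟩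
  let σ' : C((puncturedTorus Φ 0).carrier, (puncturedTorus Φ 0).carrier) :=
    ⟨σ.hom.toFun, σ.hom.mdifferentiable.continuous⟩
  -- (1) the holomorphic additive extension of `σ` to the torus
  obtain ⟨Γ, hΓd, hΓσ, hΓ0⟩ :=
    HolomorphicEllipticCuspidalization.exists_continuousAddEquiv_extension Φ Φ
      (f := σ.hom.toFun) σ.hom.isFiniteEtale σ.hom.mdifferentiable
  let Γc : C(ComplexTorus Φ, ComplexTorus Φ) := ⟨Γ, Γ.continuous⟩
  have hincl : incl.comp σ' = Γc.comp incl := by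
    ext x
    exact (hΓσ x).symm
  set M := topRep (Φ₁ := Φ) (Φ := Φ) Γ.continuous with hM
  -- the displacement of a loop class of `𝕏` at `x'`, read in the torus
  let DX : FundamentalGroup (puncturedTorus Φ 0).carrier x' → ℂ := fun γ =>
    classDisplacement Φ (Path.Homotopic.Quotient.map (FundamentalGroup.toPath γ) incl)
  -- (A) profinitely inner `θ` is invisible to the lattice coordinates
  have hA : ∀ γ, DX (θ γ) = DX γ := by
    intro γ
    -- the lattice coordinates of `incl_* γ` as a homomorphism to `Multiplicative ℤ²`
    let c : FundamentalGroup (puncturedTorus Φ 0).carrier x' →* Multiplicative (Fin 2 → ℤ) :=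
      (AddMonoidHom.toMultiplicativeRight (periodCoords Φ x'.val)).comp
        (FundamentalGroup.map incl x')
    have hsep : ∀ a : Multiplicative (Fin 2 → ℤ), a ≠ 1 →
        ∃ (B : Type) (_ : CommGroup B) (_ : Finite B) (ψ : Multiplicative (Fin 2 → ℤ) →* B), ψ a ≠ 1 := by
      intro a ha
      have hv : Multiplicative.toAdd a ≠ 0 := fun h => ha (by
        rw [← ofAdd_toAdd a, h]; rfl)
      obtain ⟨i, hi⟩ : ∃ i, Multiplicative.toAdd a i ≠ 0 := Function.ne_iff.mp hv
      let N : ℕ := (Multiplicative.toAdd a i).natAbs + 1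
      haveI : NeZero N := ⟨Nat.succ_ne_zero _⟩
      refine ⟨Multiplicative (Fin 2 → ZMod N), inferInstance, inferInstance,
        AddMonoidHom.toMultiplicative ((Int.castAddHom (ZMod N)).compLeft (Fin 2)), fun h => ?_⟩
      have h' : ∀ j, ((Multiplicative.toAdd a j : ℤ) : ZMod N) = 0 := fun j => by
        have := congrFun (congrArg Multiplicative.toAdd h) j
        exact this
      have hd : (N : ℤ) ∣ Multiplicative.toAdd a i := (ZMod.intCast_zmod_eq_zero_iff_dvd _ N).1 (h' i)
      have hlt : (Multiplicative.toAdd a i).natAbs < (N : ℤ).natAbs := by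
        rw [Int.natAbs_natCast]; exact Nat.lt_succ_self _
      exact hi (Int.eq_zero_of_dvd_of_natAbs_lt_natAbs hd hlt)
    have hc : c (θ γ) = c γ :=
      Literature.GroupTheory.map_eq_of_eta_conj_of_separating hsep θ n hn c γ
    -- read back as displacements: `Φ(coords) = D`
    have key : ∀ γ', DX γ' = latticeVec Φ (Multiplicative.toAdd (c γ')) := fun γ' => by
      change classDisplacement Φ _ = latticeVec Φ (periodCoords Φ x'.val
        (Additive.ofMul (FundamentalGroup.map incl x' γ')))
      rw [latticeVec_periodCoords, periodHom_apply]
      rfl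
    rw [key, key, hc]
  -- (B) displacement under `Γ`, for loop classes of the torus at `x'`
  have hB : ∀ p : Path.Homotopic.Quotient x'.val x'.val,
      classDisplacement Φ (p.map Γc) = realRep Φ Φ M (classDisplacement Φ p) := by
    intro p
    induction p using Path.Homotopic.Quotient.ind with | mk l =>
    rw [← Path.Homotopic.Quotient.mk_map, classDisplacement_mk, classDisplacement_mk]
    exact pathDisplacement_map_addEquiv Φ Γ l
  -- (C) `ρ_Γ` fixes the displacement of every loop of `𝕏` at `x'`
  have hC : ∀ γ : FundamentalGroup (puncturedTorus Φ 0).carrier x', realRep Φ Φ M (DX γ) = DX γ := by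
    intro γ
    -- the left-hand side of `hθ`, displaced: `D(Γ ∘ (θγ)) = ρ_Γ D(θγ) = ρ_Γ D(γ)`
    obtain ⟨q, hq⟩ := Path.Homotopic.Quotient.mk_surjective (FundamentalGroup.toPath (θ γ))
    have h1 : classDisplacement Φ (((FundamentalGroup.toPath (θ γ)).map σ').map incl) =
        realRep Φ Φ M (DX γ) := by
      rw [← hA γ]
      change _ = realRep Φ Φ M (classDisplacement Φ ((FundamentalGroup.toPath (θ γ)).map incl))
      rw [← hB, ← hq, ← Path.Homotopic.Quotient.mk_map, ← Path.Homotopic.Quotient.mk_map,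
        ← Path.Homotopic.Quotient.mk_map, ← Path.Homotopic.Quotient.mk_map, classDisplacement_mk,
        classDisplacement_mk]
      exact pathDisplacement_congr Φ _ _ (fun t => (hΓσ (q t)).symm)
    -- the right-hand side of `hθ`, displaced: `-D(δ) + D(γ) + D(δ) = D(γ)`
    obtain ⟨g, hg⟩ := Path.Homotopic.Quotient.mk_surjective (FundamentalGroup.toPath γ)
    have h2 : classDisplacement Φ (((Path.Homotopic.Quotient.mk δ).symm.trans
        ((FundamentalGroup.toPath γ).trans (Path.Homotopic.Quotient.mk δ))).map incl) = DX γ := by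
      change _ = classDisplacement Φ ((FundamentalGroup.toPath γ).map incl)
      rw [← hg, ← Path.Homotopic.Quotient.mk_symm, ← Path.Homotopic.Quotient.mk_trans,
        ← Path.Homotopic.Quotient.mk_trans, ← Path.Homotopic.Quotient.mk_map,
        ← Path.Homotopic.Quotient.mk_map, classDisplacement_mk, classDisplacement_mk,
        Path.map_trans, Path.map_trans, ← Path.map_symm, pathDisplacement_trans, pathDisplacement_trans,
        pathDisplacement_symm]
      abel
    have h := congrArg (fun p => classDisplacement Φ (Path.Homotopic.Quotient.map p incl)) (hθ γ)
    change classDisplacement Φ (((FundamentalGroup.toPath (θ γ)).map σ').map incl) =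
      classDisplacement Φ (((Path.Homotopic.Quotient.mk δ).symm.trans
        ((FundamentalGroup.toPath γ).trans (Path.Homotopic.Quotient.mk δ))).map incl) at h
    rw [h1, h2] at h
    exact h
  -- (D) hence `ρ_Γ = 1`, `Γ = id`, `σ = 1`
  have hM1 : M = 1 := by
    refine latticeVec_single_injective Φ fun i => ?_
    obtain ⟨γ, hγ⟩ := hx' i
    have h := hC (FundamentalGroup.fromPath (Path.Homotopic.Quotient.mk γ))
    have hD : DX (FundamentalGroup.fromPath (Path.Homotopic.Quotient.mk γ)) =
        latticeVec Φ (Pi.single i 1) := by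
      change classDisplacement Φ (Path.Homotopic.Quotient.map (Path.Homotopic.Quotient.mk γ) incl) = _
      rw [← Path.Homotopic.Quotient.mk_map, classDisplacement_mk]
      exact hγ
    rw [hD, realRep_latticeVec] at h
    exact h
  have hΓid : ∀ y : ComplexTorus Φ, Γ y = y := fun y => by
    have h := eq_mapMatrix_topRep_add_of_mdifferentiable (Φ₁ := Φ) (Φ := Φ) hΓd y
    rw [← hM] at h
    change Γ y = mapMatrix Φ Φ M y + Γ 0 at h
    rw [h, hM1, mapMatrix_one, hΓ0, add_zero]
  apply hom_ext
  funext x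
  apply Subtype.ext
  change (σ.hom.toFun x).val = x.val
  rw [← hΓσ x, hΓid]

/-! ### §3 A base point with the two basic lattice loops inside `E ∖ {0}`, and the unconditional
id-rigidity of «objects of `EA` mapping to `E ∖ {0}`» -/

/-- A point of the torus one of whose lattice coordinates is `1/2` is not the origin. [folklore] -/
private theorem cover_ne_zero_of_coord_eq_half (v : Fin 2 → ℝ) {j : Fin 2} (hj : v j = 1 / 2) :
    cover Φ (Φ v) ≠ 0 := by
  intro h
  obtain ⟨n, hn⟩ := (cover_eq_zero_iff Φ (Φ v)).1 h
  have hv : v = fun k => (n k : ℝ) := Φ.injective hn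
  have h2 : (1 : ℝ) / 2 = (n j : ℝ) := by rw [← hj, hv]
  have h3 : (2 * n j : ℤ) = 1 := by
    have : (2 : ℝ) * (n j : ℝ) = 1 := by rw [← h2]; norm_num
    exact_mod_cast this
  omega

/-- **The base point `π(Φ(½,½))` of `E ∖ {0}` carries the two basic lattice loops**: for `i = 0, 1`
the straight segment from `Φ(½,½)` to `Φ(½,½) + Φ(e_i)` projects to a loop INSIDE `E ∖ {0}` (its
other coordinate stays `½`) with displacement `Φ(e_i)`.  [cite: Lange2023AbelianVarietiesComplex, §1.1.3 (1.3)] -/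
theorem exists_basepoint_basis_loops :
    ∃ x' : (puncturedTorus Φ 0).carrier, ∀ i : Fin 2, ∃ γ : Path x' x',
      pathDisplacement Φ (γ.map continuous_subtype_val) = latticeVec Φ (Pi.single i 1) := by
  let half : Fin 2 → ℝ := fun _ => 1 / 2
  let e : Fin 2 → Fin 2 → ℝ := fun i j => ((Pi.single i (1 : ℤ) : Fin 2 → ℤ) j : ℝ)
  have he : ∀ i, Φ (e i) = latticeVec Φ (Pi.single i 1) := fun i => rfl
  -- the other coordinate of `half + t • e i` is `1/2`
  have hcoord : ∀ (i : Fin 2) (t : ℝ), ∃ j, (half + t • e i) j = 1 / 2 := by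
    intro i t
    refine ⟨i + 1, ?_⟩
    have hne : i + 1 ≠ i := by
      intro h
      have := congrArg Fin.val h
      fin_cases i <;> simp at this
    simp [half, e, Pi.single_apply, hne]
  have hmem : ∀ (i : Fin 2) (t : ℝ), cover Φ (Φ (half + t • e i)) ∈
      ((⟨{(0 : ComplexTorus Φ)}ᶜ, isOpen_compl_singleton⟩ : TopologicalSpace.Opens (ComplexTorus Φ)) :
        Set (ComplexTorus Φ)) := by
    intro i t
    obtain ⟨j, hj⟩ := hcoord i t
    exact cover_ne_zero_of_coord_eq_half Φ _ hj
  have hmem0 : cover Φ (Φ half) ∈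
      ((⟨{(0 : ComplexTorus Φ)}ᶜ, isOpen_compl_singleton⟩ : TopologicalSpace.Opens (ComplexTorus Φ)) :
        Set (ComplexTorus Φ)) := by
    have h := hmem 0 0
    simpa using h
  refine ⟨⟨cover Φ (Φ half), hmem0⟩, fun i => ?_⟩
  -- the lift: the straight segment
  let L : C(unitInterval, ℂ) :=
    ⟨fun t => Φ (half + (t : ℝ) • e i),
      Φ.continuous.comp (continuous_const.add (continuous_subtype_val.smul continuous_const))⟩
  have hL1 : Φ (half + (1 : ℝ) • e i) = Φ half + latticeVec Φ (Pi.single i 1) := by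
    rw [one_smul, map_add, he]
  let γ : Path (⟨cover Φ (Φ half), hmem0⟩ : (puncturedTorus Φ 0).carrier) ⟨cover Φ (Φ half), hmem0⟩ :=
    { toFun := fun t => ⟨cover Φ (L t), hmem i t⟩
      continuous_toFun := ((continuous_cover Φ).comp L.continuous).subtype_mk _
      source' := by
        apply Subtype.ext
        change cover Φ (Φ (half + ((0 : unitInterval) : ℝ) • e i)) = cover Φ (Φ half)
        simp
      target' := by
        apply Subtype.ext
        change cover Φ (Φ (half + ((1 : unitInterval) : ℝ) • e i)) = cover Φ (Φ half)
        rw [Set.Icc.coe_one, hL1, cover_add_latticeVec] }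
  refine ⟨γ, ?_⟩
  rw [pathDisplacement_eq_sub_of_lift Φ _ (Γ := L) L.continuous (fun t => rfl)]
  change Φ (half + ((1 : unitInterval) : ℝ) • e i) - Φ (half + ((0 : unitInterval) : ℝ) • e i) = _
  rw [Set.Icc.coe_one, Set.Icc.coe_zero, hL1, zero_smul, add_zero, add_sub_cancel_left]

/-- **[AbsTopIII] Prop. 4.2 (i) at the once-punctured elliptic curve, UNCONDITIONALLY**: the full
subcategory of `HolRS` of objects mapping (holomorphically, finite étale) to `E ∖ {0}` — print's
«objects of `EA` that map to `X`» for `X` of type `(1,1)`, the carrier of the elliptic cuspidalization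
and of IUT's `X_v` at an archimedean place — is ID-RIGID.  Inputs: the slice is id-rigid because
`π̂₁(E ∖ {0}) = F̂₂` is slim (abc-iut-w5-d016, abc-iut-L4-t12), and (OUT) holds
(`puncturedTorus_zero_outer`); no (H1) (which fails here: `[-1] ∈ Aut(E, 0)`).
[cite: MochizukiAbsTopIII2015, Proposition 4.2 (i) p.106] -/
theorem isIdRigid_mapsTo_puncturedTorus_zero :
    IsIdRigid (ObjectProperty.FullSubcategory fun Y : HolRS => Nonempty (Y ⟶ puncturedTorus Φ 0)) := by
  obtain ⟨x', hx'⟩ := exists_basepoint_basis_loops Φ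
  obtain ⟨e⟩ := nonempty_mulEquiv_freeGroup_puncturedTorus Φ 0 x'
  exact (puncturedTorus Φ 0).isIdRigid_mapsTo_of_isSlimGroup_of_outer x'
    (Literature.GroupTheory.isSlimGroup_profiniteCompletion_of_mulEquiv_freeGroup e le_rfl)
    (fun σ δ θ hθ hn => puncturedTorus_zero_outer Φ x' hx' σ δ θ hθ hn)


/-! ### §4 Every once-punctured elliptic curve `E ∖ {x₀}`: translation to `E ∖ {0}` -/

/-- **Translation `E ∖ {x₀} ≅ E ∖ {0}` in `HolRS`**: the translation `y ↦ y - x₀` of the torus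
(biholomorphic, Lange–Birkenhake §1.1.2) restricts to an isomorphism of the punctured curves.
[cite: LangeBirkenhake1992, §1.1.2] -/
theorem nonempty_iso_puncturedTorus_zero (x₀ : ComplexTorus Φ) :
    Nonempty (puncturedTorus Φ x₀ ≅ puncturedTorus Φ 0) := by
  have hmem : ∀ y : (puncturedTorus Φ x₀).carrier, y.val + -x₀ ∈
      ((⟨{(0 : ComplexTorus Φ)}ᶜ, isOpen_compl_singleton⟩ : TopologicalSpace.Opens (ComplexTorus Φ)) :
        Set (ComplexTorus Φ)) := fun y h => by
    have hy : y.val ≠ x₀ := y.property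
    exact hy (by simpa [add_neg_eq_zero] using h)
  have hmem' : ∀ z : (puncturedTorus Φ 0).carrier, z.val + x₀ ∈
      ((⟨{x₀}ᶜ, isOpen_compl_singleton⟩ : TopologicalSpace.Opens (ComplexTorus Φ)) :
        Set (ComplexTorus Φ)) := fun z h => by
    have hz : z.val ≠ 0 := z.property
    exact hz (by simpa using h)
  let e : (puncturedTorus Φ x₀).carrier ≃ₜ (puncturedTorus Φ 0).carrier :=
    { toFun := fun y => ⟨y.val + -x₀, hmem y⟩
      invFun := fun z => ⟨z.val + x₀, hmem' z⟩
      left_inv := fun y => Subtype.ext (by simp)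
      right_inv := fun z => Subtype.ext (by simp)
      continuous_toFun := (continuous_subtype_val.add continuous_const).subtype_mk _
      continuous_invFun := (continuous_subtype_val.add continuous_const).subtype_mk _ }
  have hd : MDifferentiable 𝓘(ℂ, ℂ) 𝓘(ℂ, ℂ) e :=
    mdifferentiable_opens_of_val_eq'
      ((ComplexTorus.contMDiff_add_const (Φ := Φ) (𝕜 := ℂ) (n := 1) (-x₀)).mdifferentiable one_ne_zero)
      e (fun _ => rfl)
  have hd' : MDifferentiable 𝓘(ℂ, ℂ) 𝓘(ℂ, ℂ) e.symm :=
    mdifferentiable_opens_of_val_eq'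
      ((ComplexTorus.contMDiff_add_const (Φ := Φ) (𝕜 := ℂ) (n := 1) x₀).mdifferentiable one_ne_zero)
      e.symm (fun _ => rfl)
  refine ⟨⟨⟨e, hd, IsFiniteEtale.of_homeomorph e⟩, ⟨e.symm, hd', IsFiniteEtale.of_homeomorph e.symm⟩,
    hom_ext (funext fun y => e.symm_apply_apply y), hom_ext (funext fun z => e.apply_symm_apply z)⟩⟩

/-- **[AbsTopIII] Prop. 4.2 (i) at EVERY once-punctured elliptic curve `E ∖ {x₀}`, unconditionally**:
«objects of `EA` mapping to `E ∖ {x₀}`» is id-rigid (the object property is the same as for `E ∖ {0}`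
along the translation isomorphism). [cite: MochizukiAbsTopIII2015, Proposition 4.2 (i) p.106] -/
theorem isIdRigid_mapsTo_puncturedTorus (x₀ : ComplexTorus Φ) :
    IsIdRigid (ObjectProperty.FullSubcategory fun Y : HolRS => Nonempty (Y ⟶ puncturedTorus Φ x₀)) := by
  obtain ⟨i⟩ := nonempty_iso_puncturedTorus_zero Φ x₀
  have h : (fun Y : HolRS => Nonempty (Y ⟶ puncturedTorus Φ x₀)) =
      fun Y : HolRS => Nonempty (Y ⟶ puncturedTorus Φ 0) := by
    funext Y
    exact propext ⟨fun ⟨f⟩ => ⟨f ≫ i.hom⟩, fun ⟨f⟩ => ⟨f ≫ i.inv⟩⟩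
  rw [h]
  exact isIdRigid_mapsTo_puncturedTorus_zero Φ

end HolRS

end Literature.AnabelianGeometry.AbsoluteAnabelian
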